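import Summits.Ventures.Crystal3D.Theorems.StickyWulffConstantCoaxialWallLawAdaptedFrame
import Summits.Ventures.Crystal3D.Theorems.StickyWulffConstantCoaxialWallLawCslRigidTwinStub
import HarnessLib

/-!
# The rigid rung of `stub_coaxialTwoSlabAdhesion` for EVERY co-axial pair of distinct grains

HONEST FRAMING. Part of the venture `Summits/Ventures/Crystal3D` (cell `crystal3d-full`), helper
`--supports` the crux `CoaxialWallLaw` (stmt-Ventures-19481, `route-Ventures-StickyWulffConstant`),
REGISTERED line `WallLedgerF` (planner cf-p1 gen 16), stub `stub_coaxialTwoSlabAdhesion`.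
RUNG CREDIT ONLY: the stub quantifies over ARBITRARY unit-separated fillings `X`; here the filling is
RIGID (`X ⊆ Λ₁ ∪ Λ₂`).  Rung F-C1 is not moved.

`coaxialTwoSlabAdhesion_rigid` has exactly the two hypotheses of
`Summit.Ventures.Crystal3D.Cruxes.CoaxialWallLaw.WallLedgerF.CoaxialTwoSlabAdhesion` (co-axiality,
`Λ₁ ≠ Λ₂`) and exactly its conclusion, with the single extra premise `∀ p ∈ X, p ∈ Λ₁ ∨ p ∈ Λ₂`
inside.  It is the case split

* `A₁·Λ₀ ≠ A₂·Λ₀` (twin pair): `coaxialTwoSlabAdhesion_rigid_twinPair` (`…CslRigidTwinStub`, itself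
  CSL / non-CSL);
* `A₁·Λ₀ = A₂·Λ₀` (translation pair): the grains are then disjoint (`movedFcc_subset_of_common_point`:
  a common point forces `Λ₁ = Λ₂`), and `coaxialTwoSlabAdhesion_rigid_translatePair`
  (`…AdaptedFrame`) applies.
-/

noncomputable section

namespace Summit.Ventures.Crystal3D.Theorems

open Summit.Ventures.Crystal3D Finset
open Literature.MathematicalPhysics.StatisticalMechanics (barlowStacking fccStacking
  IsHaggSeq contactDeficiency)
open scoped InnerProductSpace

/-- Two translates of the SAME linear lattice `A₁·Λ₀ = A₂·Λ₀` with a common point coincide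
(one inclusion; swap the roles for the other). -/
theorem movedFcc_subset_of_common_point
    (A₁ : EuclideanSpace ℝ (Fin 3) ≃ₗᵢ[ℝ] EuclideanSpace ℝ (Fin 3)) (t₁ : EuclideanSpace ℝ (Fin 3))
    (A₂ : EuclideanSpace ℝ (Fin 3) ≃ₗᵢ[ℝ] EuclideanSpace ℝ (Fin 3)) (t₂ : EuclideanSpace ℝ (Fin 3))
    (hsame : A₁ '' fccStacking 1 (Real.sqrt (2 / 3)) = A₂ '' fccStacking 1 (Real.sqrt (2 / 3)))
    {c : EuclideanSpace ℝ (Fin 3)}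
    (hc₁ : c ∈ (fun q => A₁ q + t₁) '' fccStacking 1 (Real.sqrt (2 / 3)))
    (hc₂ : c ∈ (fun q => A₂ q + t₂) '' fccStacking 1 (Real.sqrt (2 / 3))) :
    (fun q => A₁ q + t₁) '' fccStacking 1 (Real.sqrt (2 / 3)) ⊆
      (fun q => A₂ q + t₂) '' fccStacking 1 (Real.sqrt (2 / 3)) := by
  rintro x ⟨q, hq, rfl⟩
  obtain ⟨q₁, hq₁, hc₁e⟩ := hc₁
  obtain ⟨q₂, hq₂, hc₂e⟩ := hc₂
  simp only at hc₁e hc₂e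
  have hmem : A₁ (q - q₁) ∈ A₂ '' fccStacking 1 (Real.sqrt (2 / 3)) := by
    rw [← hsame]; exact ⟨q - q₁, fcc_sub_site_mem hq hq₁, rfl⟩
  obtain ⟨r, hr, hre⟩ := hmem
  refine ⟨r + q₂, fcc_add_site_mem hr hq₂, ?_⟩
  show A₂ (r + q₂) + t₂ = A₁ q + t₁
  calc A₂ (r + q₂) + t₂ = A₂ r + (A₂ q₂ + t₂) := by rw [map_add]; abel
    _ = A₁ (q - q₁) + (A₁ q₁ + t₁) := by rw [hre, hc₂e, hc₁e]
    _ = A₁ q + t₁ := by rw [map_sub]; abel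

/-- **The rigid rung of `stub_coaxialTwoSlabAdhesion` (all co-axial pairs of distinct grains).**
The stub's hypotheses and conclusion verbatim, with the extra premise `∀ p ∈ X, p ∈ Λ₁ ∨ p ∈ Λ₂`
(rigid filling) inside; `R₀ = 3` in both branches. -/
theorem coaxialTwoSlabAdhesion_rigid
    (A₁ : EuclideanSpace ℝ (Fin 3) ≃ₗᵢ[ℝ] EuclideanSpace ℝ (Fin 3)) (t₁ : EuclideanSpace ℝ (Fin 3))
    (A₂ : EuclideanSpace ℝ (Fin 3) ≃ₗᵢ[ℝ] EuclideanSpace ℝ (Fin 3)) (t₂ : EuclideanSpace ℝ (Fin 3))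
    (hcoax : ∃ (L : EuclideanSpace ℝ (Fin 3) ≃ₗᵢ[ℝ] EuclideanSpace ℝ (Fin 3))
        (s₁ s₂ : EuclideanSpace ℝ (Fin 3)) (σ σ' : ℤ → ℤ), IsHaggSeq σ ∧ IsHaggSeq σ' ∧
        (fun p => A₁ p + t₁) '' fccStacking 1 (Real.sqrt (2 / 3)) ⊆
          (fun p => L p + s₁) '' barlowStacking 1 (Real.sqrt (2 / 3)) σ ∧
        (fun p => A₂ p + t₂) '' fccStacking 1 (Real.sqrt (2 / 3)) ⊆
          (fun p => L p + s₂) '' barlowStacking 1 (Real.sqrt (2 / 3)) σ')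
    (hne : (fun p => A₁ p + t₁) '' fccStacking 1 (Real.sqrt (2 / 3)) ≠
      (fun p => A₂ p + t₂) '' fccStacking 1 (Real.sqrt (2 / 3))) :
    ∃ (L : EuclideanSpace ℝ (Fin 3) ≃ₗᵢ[ℝ] EuclideanSpace ℝ (Fin 3))
        (s₁ s₂ : EuclideanSpace ℝ (Fin 3)) (σ σ' : ℤ → ℤ), IsHaggSeq σ ∧ IsHaggSeq σ' ∧
        (fun p => A₁ p + t₁) '' fccStacking 1 (Real.sqrt (2 / 3)) ⊆
          (fun p => L p + s₁) '' barlowStacking 1 (Real.sqrt (2 / 3)) σ ∧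
        (fun p => A₂ p + t₂) '' fccStacking 1 (Real.sqrt (2 / 3)) ⊆
          (fun p => L p + s₂) '' barlowStacking 1 (Real.sqrt (2 / 3)) σ' ∧
    ∃ C R₀ : ℝ, 1 ≤ R₀ ∧ ∀ h : ℝ, 0 ≤ h → ∀ ρ : ℝ, R₀ ≤ ρ →
      ∀ X P₁ P₂ : Finset (EuclideanSpace ℝ (Fin 3)),
      (∀ p ∈ X, ∀ q ∈ X, p ≠ q → 1 ≤ dist p q) → P₁ ⊆ X → P₂ ⊆ X \ P₁ →
      (∀ p ∈ X, -(2 * R₀) ≤ p 2 ∧ p 2 ≤ h + 2 * R₀ ∧ p 0 ^ 2 + p 1 ^ 2 ≤ ρ ^ 2) →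
      (∀ p, p ∈ P₁ ↔ (p ∈ (fun q => A₁ q + t₁) '' fccStacking 1 (Real.sqrt (2 / 3)) ∧
        -(2 * R₀) ≤ p 2 ∧ p 2 ≤ -R₀ ∧ p 0 ^ 2 + p 1 ^ 2 ≤ ρ ^ 2)) →
      (∀ p, p ∈ P₂ ↔ (p ∈ (fun q => A₂ q + t₂) '' fccStacking 1 (Real.sqrt (2 / 3)) ∧
        h + R₀ ≤ p 2 ∧ p 2 ≤ h + 2 * R₀ ∧ p 0 ^ 2 + p 1 ^ 2 ≤ ρ ^ 2)) →
      (∀ p ∈ X, p ∈ (fun q => A₁ q + t₁) '' fccStacking 1 (Real.sqrt (2 / 3)) ∨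
        p ∈ (fun q => A₂ q + t₂) '' fccStacking 1 (Real.sqrt (2 / 3))) →
      ((((P₁ ×ˢ (X \ P₁)).filter fun pq => dist pq.1 pq.2 = 1).card : ℕ) : ℝ) +
        ((((P₂ ×ˢ ((X \ P₁) \ P₂)).filter fun pq => dist pq.1 pq.2 = 1).card : ℕ) : ℝ) ≤
        contactDeficiency ((X \ P₁) \ P₂) +
          (Real.sqrt 2 / 4 * ∑ᶠ w ∈ {w ∈ fccStacking 1 (Real.sqrt (2 / 3)) | ‖w‖ = 1},
              |⟪w, A₁.symm (EuclideanSpace.single (2 : Fin 3) (1 : ℝ))⟫_ℝ| +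
            Real.sqrt 2 / 4 * ∑ᶠ w ∈ {w ∈ fccStacking 1 (Real.sqrt (2 / 3)) | ‖w‖ = 1},
              |⟪w, A₂.symm (EuclideanSpace.single (2 : Fin 3) (1 : ℝ))⟫_ℝ| -
            (1 / 2 : ℝ) * Real.sqrt (1 - ⟪L (EuclideanSpace.single (2 : Fin 3) (1 : ℝ)),
              (EuclideanSpace.single (2 : Fin 3) (1 : ℝ))⟫_ℝ ^ 2)) * Real.pi * ρ ^ 2 +
          C * (1 + h) * ρ := by
  by_cases hsame : A₁ '' fccStacking 1 (Real.sqrt (2 / 3)) = A₂ '' fccStacking 1 (Real.sqrt (2 / 3))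
  · refine coaxialTwoSlabAdhesion_rigid_translatePair A₁ t₁ A₂ t₂ hcoax hsame ?_
    intro p hp₁ hp₂
    exact hne (Set.Subset.antisymm (movedFcc_subset_of_common_point A₁ t₁ A₂ t₂ hsame hp₁ hp₂)
      (movedFcc_subset_of_common_point A₂ t₂ A₁ t₁ hsame.symm hp₂ hp₁))
  · exact coaxialTwoSlabAdhesion_rigid_twinPair A₁ t₁ A₂ t₂ hcoax hsame

end Summit.Ventures.Crystal3D.Theorems

end
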